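import Summits.Schanuel.Schanuel.Theorems.DiophantineDichotomyApproximationPropertyZeroDimDictionaryValue
import Summits.Schanuel.Schanuel.Theorems.DiophantineDichotomyApproximationPropertyDefs
import Literature.NumberTheory.Transcendental.PhilipponCriterionRank
import HarnessLib

/-!
# The 0-dimensional dictionary: `stub_zeroDimDictionary : ZeroDimDictionary` (stmt-Schanuel-6117)

Crux `stmt-Schanuel-6117` (`Summit.Schanuel.Schanuel.Theses.DiophantineDichotomy.ApproximationProperty`),
route `DiophantineDichotomy`, line `orbit-interpolation-determinant`. This file PROVES the registered
stub `stub_zeroDimDictionary : ZeroDimDictionary` of the checked skeleton (definitions module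
`DiophantineDichotomyApproximationPropertyDefs.lean`): for `m ≥ 1` there is `c = c(m) > 0`
(here `c = m(m+1)/2 + log(m+1)`) such that every homogeneous prime `𝔭 ⊂ ℚ[x₀, …, x_m]` of rank `1`
has a number field `K = ℚ(b̄)` and `b̄ ∈ K^{m+1} ∖ 0` with (A) `V(𝔭) = {λ σ(b̄) : σ : K → ℂ}`,
(B′) distinct embeddings give distinct points, (B) `[K:ℚ] = deg 𝔭`, (C) `h_K(b̄) ≤ h(𝔭) + c deg 𝔭`,
(D) `|𝔭(ω̄)| ≥ e^{−c deg 𝔭} ∏_σ ‖ω̄ − σ(b̄)‖`, (E) if `b₀ ≠ 0` and the zeros of `𝔭` impose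
independent conditions on the forms of degree `δ`, the monomials of degree `≤ δ` in `b̄/b₀` span `K`
over `ℚ`. Parts I–III (`…ZeroDimDictionaryZeros/Degree/Value.lean`) carry (A)–(D); here:

* `mem_iff_aeval_eq_zero` — a form lies in `𝔭` iff it vanishes at `b̄` (the tree's Nullstellensatz
  over `ℚ` with complex points `PhilipponMain.mem_of_forall_mem_projZeros_aeval_eq_zero` + (A));
* `exists_poly_of_interpolation` (E) — rank–nullity for `ℚ[x̲]_δ → K`, `G ↦ G(b̄/b₀)`, whose kernel
  is `𝔭_δ`, and dehomogenisation;
* `stub_zeroDimDictionary` — the assembly.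

Sources: Nesterenko, LNM 1752 Ch. 3 §4 (Prop. 4.4, Def. 4.6, property 3 of `|I(ω̄)|`), §5
(p. 42), Ch. 7 §4.3; Philippon 1986 §1; Bombieri–Gubler §1.6.
-/

noncomputable section

-- `Summit.Schanuel.Schanuel.…` is the mandated summit/sub-problem namespace (single-conjunct summit), hence:
set_option linter.dupNamespace false

namespace Summit.Schanuel.Schanuel.Cruxes.ApproximationProperty.OrbitInterpolationDeterminant

open Literature.NumberTheory.Transcendental.Nesterenko MvPolynomial
open scoped BigOperators

variable {m : ℕ}

/-! ## §5  Interpolation: the monomials of degree `≤ δ` in the affine coordinates span `K` -/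

section Span

variable {𝔭 : Ideal (Rx m)}

/-- Substituting polynomials of total degree `≤ 1` does not increase the total degree. [folklore] -/
-- adapted from `totalDegree_aeval_le_of_le_one` (CafureMateraLemma22MultiplicityProofs)
theorem totalDegree_aeval_le_of_le_one {σ τ : Type*} (g : σ → MvPolynomial τ ℚ)
    (hg : ∀ i, (g i).totalDegree ≤ 1) (p : MvPolynomial σ ℚ) :
    (aeval g p).totalDegree ≤ p.totalDegree := by
  classical
  conv_lhs => rw [p.as_sum]
  rw [map_sum]
  refine totalDegree_finsetSum_le fun s hs => ?_
  rw [aeval_monomial, Finsupp.prod]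
  calc (algebraMap ℚ (MvPolynomial τ ℚ) (coeff s p) * ∏ i ∈ s.support, g i ^ s i).totalDegree
      ≤ (algebraMap ℚ (MvPolynomial τ ℚ) (coeff s p)).totalDegree +
          (∏ i ∈ s.support, g i ^ s i).totalDegree := totalDegree_mul _ _
    _ ≤ 0 + ∑ i ∈ s.support, s i := by
        gcongr
        · rw [MvPolynomial.algebraMap_eq, totalDegree_C]
        · refine (totalDegree_finsetProd _ _).trans (Finset.sum_le_sum fun i _ => ?_)
          calc (g i ^ s i).totalDegree ≤ s i * (g i).totalDegree := totalDegree_pow _ _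
            _ ≤ s i * 1 := Nat.mul_le_mul_left _ (hg i)
            _ = s i := mul_one _
    _ = s.sum fun _ e => e := by rw [zero_add]; rfl
    _ ≤ p.totalDegree := le_totalDegree hs

/-- Values at `b̄` in `K` and at `b̄'` in `ℂ`. [folklore] -/
theorem coe_aeval_eq {b' : Fin (m + 1) → ℂ}
    {b : Fin (m + 1) → ↥(IntermediateField.adjoin ℚ (Set.range b'))} (hb : ∀ k, (b k : ℂ) = b' k)
    (P : Rx m) : ((aeval b P : ↥(IntermediateField.adjoin ℚ (Set.range b'))) : ℂ) = aeval b' P := by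
  have h := comp_aeval_apply (R := ℚ) (f := b) (φ := IntermediateField.val _) (p := P)
  rw [IntermediateField.coe_val] at h
  exact h.trans (congrArg (fun f => aeval f P) (funext fun k => hb k))

/-- **`𝔭` is the ideal of all forms vanishing at `b̄`**: a form `G` of degree `δ` lies in `𝔭` iff
`G(b̄) = 0` (every zero of `𝔭` is a multiple of a conjugate of `b̄`, and `𝔭` is its own vanishing
ideal). [cite: NesterenkoPhilippon2001, Ch. 3 §5 (p. 42)] -/
theorem mem_iff_aeval_eq_zero (h𝔭 : 𝔭.IsPrime)
    (hhom : letI := MvPolynomial.gradedAlgebra (σ := Fin (m + 1)) (R := ℚ);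
      𝔭.IsHomogeneous (homogeneousSubmodule (Fin (m + 1)) ℚ)) (hunm : IsUnmixedOfRank 𝔭 1)
    {b' : Fin (m + 1) → ℂ} (hb' : b' ∈ projZeros 𝔭) {j : Fin (m + 1)} (hj : b' j = 1)
    [NumberField ↥(IntermediateField.adjoin ℚ (Set.range b'))]
    {b : Fin (m + 1) → ↥(IntermediateField.adjoin ℚ (Set.range b'))} (hb : ∀ k, (b k : ℂ) = b' k)
    {G : Rx m} {δ : ℕ} (hG : G.IsHomogeneous δ) : G ∈ 𝔭 ↔ aeval b G = 0 := by
  constructor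
  · intro hG𝔭
    apply Subtype.ext
    rw [coe_aeval_eq hb, hb'.2 G hG𝔭]
    rfl
  · intro h0
    have hb'0 : aeval b' G = 0 := by rw [← coe_aeval_eq hb, h0]; rfl
    refine Literature.NumberTheory.Transcendental.PhilipponMain.mem_of_forall_mem_projZeros_aeval_eq_zero
      h𝔭 ?_ fun β hβ => ?_
    · have h := Literature.NumberTheory.Transcendental.NesterenkoK.aeval_smul_of_isHomogeneous hG
        (0 : ℂ) b'
      rw [zero_smul, hb'0, mul_zero] at h
      exact h
    · obtain ⟨-, σ, l, rfl⟩ := (mem_projZeros_iff h𝔭 hhom hunm hb' hj hb β).mp hβ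
      have e : (fun k => l * σ (b k)) = l • fun k => σ (b k) := rfl
      rw [e, Literature.NumberTheory.Transcendental.NesterenkoK.aeval_smul_of_isHomogeneous hG,
        show aeval (fun k => σ (b k)) G = σ (aeval b G) from
          (comp_aeval_apply (f := b) (φ := σ.toRatAlgHom) (p := G)).symm, h0, map_zero, mul_zero]

/-- **(E) Interpolation degree**: if `b₀ ≠ 0` and the zeros of `𝔭` impose independent conditions on
the forms of degree `δ` (`dim ℚ[x̲]_δ = dim 𝔭_δ + deg 𝔭`), then every element of `K = ℚ(b̄')` is
`Q(b₁/b₀, …, b_m/b₀)` for a rational polynomial `Q` of total degree `≤ δ` (the evaluation map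
`ℚ[x̲]_δ → K`, `G ↦ G(b̄/b₀)`, has kernel `𝔭_δ`, hence rank `deg 𝔭 = [K:ℚ]`).
[cite: NesterenkoPhilippon2001, Ch. 3 §5 (p. 42); Philippon1986Criteres, §1] -/
theorem exists_poly_of_interpolation (h𝔭 : 𝔭.IsPrime)
    (hhom : letI := MvPolynomial.gradedAlgebra (σ := Fin (m + 1)) (R := ℚ);
      𝔭.IsHomogeneous (homogeneousSubmodule (Fin (m + 1)) ℚ)) (hunm : IsUnmixedOfRank 𝔭 1)
    {b' : Fin (m + 1) → ℂ} (hb' : b' ∈ projZeros 𝔭) {j : Fin (m + 1)} (hj : b' j = 1)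
    [NumberField ↥(IntermediateField.adjoin ℚ (Set.range b'))]
    {b : Fin (m + 1) → ↥(IntermediateField.adjoin ℚ (Set.range b'))} (hb : ∀ k, (b k : ℂ) = b' k)
    (hb0 : b 0 ≠ 0) (δ : ℕ)
    (hH : Module.finrank ℚ ↥(homogeneousSubmodule (Fin (m + 1)) ℚ δ) =
      Module.finrank ℚ ↥(homogeneousSubmodule (Fin (m + 1)) ℚ δ ⊓ 𝔭.restrictScalars ℚ) + ideg 𝔭 1)
    (z : ↥(IntermediateField.adjoin ℚ (Set.range b'))) :
    ∃ Q : MvPolynomial (Fin m) ℚ, Q.totalDegree ≤ δ ∧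
      MvPolynomial.aeval (fun k : Fin m => b k.succ / b 0) Q = z := by
  classical
  set a : Fin (m + 1) → ↥(IntermediateField.adjoin ℚ (Set.range b')) := fun k => b k / b 0 with ha
  have hba : b = b 0 • a := by
    funext k
    simp only [ha, Pi.smul_apply, smul_eq_mul]
    rw [mul_div_cancel₀ _ hb0]
  -- the kernel of `G ↦ G(a)` on the forms of degree `δ` is `𝔭_δ`
  have hker : ∀ G : Rx m, G.IsHomogeneous δ → (aeval a G = 0 ↔ G ∈ 𝔭) := by
    intro G hG
    rw [mem_iff_aeval_eq_zero h𝔭 hhom hunm hb' hj hb hG, hba,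
      Literature.NumberTheory.Transcendental.NesterenkoK.aeval_smul_of_isHomogeneous hG,
      mul_eq_zero, or_iff_right (pow_ne_zero _ hb0)]
  set W : Submodule ℚ (Rx m) := homogeneousSubmodule (Fin (m + 1)) ℚ δ with hW
  haveI : FiniteDimensional ℚ ↥W := Module.Finite.iff_fg.mpr (homogeneousSubmodule_fg _ _ δ)
  set ev : ↥W →ₗ[ℚ] ↥(IntermediateField.adjoin ℚ (Set.range b')) :=
    (aeval a).toLinearMap.comp W.subtype with hev
  have hkerW : LinearMap.ker ev = Submodule.comap W.subtype (W ⊓ 𝔭.restrictScalars ℚ) := by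
    ext ⟨G, hG⟩
    have hG' : G.IsHomogeneous δ := (mem_homogeneousSubmodule δ G).mp hG
    simp only [LinearMap.mem_ker, hev, LinearMap.comp_apply, Submodule.subtype_apply,
      AlgHom.toLinearMap_apply, Submodule.mem_comap, Submodule.mem_inf, hG, true_and,
      Submodule.restrictScalars_mem]
    exact hker G hG'
  have hfr : Module.finrank ℚ ↥(LinearMap.ker ev) =
      Module.finrank ℚ ↥(W ⊓ 𝔭.restrictScalars ℚ) := by
    rw [hkerW]
    exact LinearEquiv.finrank_eq (Submodule.comapSubtypeEquivOfLe inf_le_left)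
  have hrn := LinearMap.finrank_range_add_finrank_ker ev
  have hrange : Module.finrank ℚ ↥(LinearMap.range ev) =
      Module.finrank ℚ ↥(IntermediateField.adjoin ℚ (Set.range b')) := by
    rw [finrank_eq_ideg h𝔭 hhom hunm hb' hj hb]
    rw [hfr] at hrn
    exact Nat.add_right_cancel ((hrn.trans hH).trans (add_comm _ _))
  have htop : LinearMap.range ev = ⊤ := Submodule.eq_top_of_finrank_eq hrange
  obtain ⟨⟨G, hG⟩, hGz⟩ : z ∈ LinearMap.range ev := by rw [htop]; exact Submodule.mem_top
  have hG' : G.IsHomogeneous δ := (mem_homogeneousSubmodule δ G).mp hG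
  -- dehomogenise
  refine ⟨aeval (Fin.cons 1 X : Fin (m + 1) → MvPolynomial (Fin m) ℚ) G, ?_, ?_⟩
  · refine (totalDegree_aeval_le_of_le_one _ (fun i => ?_) G).trans hG'.totalDegree_le
    refine Fin.cases ?_ (fun k => ?_) i
    · simp
    · simp [totalDegree_X]
  · have h := congrArg (fun φ : Rx m →ₐ[ℚ] ↥(IntermediateField.adjoin ℚ (Set.range b')) => φ G)
      (comp_aeval (R := ℚ) (f := (Fin.cons 1 X : Fin (m + 1) → MvPolynomial (Fin m) ℚ))
        (aeval fun k : Fin m => b k.succ / b 0))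
    simp only [AlgHom.comp_apply] at h
    rw [h]
    have hfun : (fun i => aeval (fun k : Fin m => b k.succ / b 0)
        ((Fin.cons 1 X : Fin (m + 1) → MvPolynomial (Fin m) ℚ) i)) = a := by
      funext i
      refine Fin.cases ?_ (fun k => ?_) i
      · simp [ha, div_self hb0]
      · simp [ha]
    rw [hfun]
    simpa [hev] using hGz

end Span

/-! ## §6  The registered stub -/

/-- **Stub 3b — `ZeroDimDictionary`**: the structure of a homogeneous prime `𝔭 ⊂ ℚ[x₀, …, x_m]` of
rank `1` in Nesterenko's elimination language, with the constant `c(m) = m(m+1)/2 + log(m+1)`: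
`K = ℚ(b̄)` the field of a normalised zero `b̄` (`b_j = 1`), (A) `V(𝔭) = {λ σ(b̄)}`, (B′) distinct
embeddings give distinct points, (B) `[K:ℚ] = deg 𝔭`, (C) `h_K(b̄) ≤ h(𝔭) + c deg 𝔭`,
(D) `|𝔭(ω̄)| ≥ e^{−c deg 𝔭} ∏_σ ‖ω̄ − σ(b̄)‖`, (E) interpolation in degree `δ` ⇒ the monomials of
degree `≤ δ` in `b̄/b₀` span `K`. [cite: NesterenkoPhilippon2001, Ch. 3 §4 (Prop. 4.4, Def. 4.6,
property 3 of `|I(ω̄)|`), §5 (p. 42); Philippon1986Criteres, §1] -/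
theorem stub_zeroDimDictionary : ZeroDimDictionary := by
  intro m hm
  have hlog : (0 : ℝ) < Real.log (m + 1) :=
    Real.log_pos (by exact_mod_cast (by omega : 1 < m + 1))
  refine ⟨(Fintype.card (Fin 1 × SkewIdx m) : ℝ) + Real.log (m + 1),
    add_pos_of_nonneg_of_pos (Nat.cast_nonneg _) hlog, ?_⟩
  intro 𝔭 h𝔭 hhom hunm
  classical
  -- a normalised zero `b̄'`, `b'_j = 1`, and its field `K = ℚ(b̄')`
  obtain ⟨β₀, hβ₀⟩ := projZeros_nonempty' h𝔭 hhom hunm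
  obtain ⟨j, hj0⟩ := Function.ne_iff.mp hβ₀.1
  have hb' : (β₀ j)⁻¹ • β₀ ∈ projZeros 𝔭 :=
    Literature.NumberTheory.Transcendental.PhilipponMain.smul_mem_projZeros
      (fun P hP k => homogeneousComponent_mem_of_mem hhom hP k) hβ₀ (inv_ne_zero hj0)
  have hj : ((β₀ j)⁻¹ • β₀) j = 1 := by
    rw [Pi.smul_apply, smul_eq_mul, inv_mul_cancel₀ hj0]
  haveI := numberField_adjoin h𝔭 hhom hunm hb' hj
  let b : Fin (m + 1) → ↥(IntermediateField.adjoin ℚ (Set.range ((β₀ j)⁻¹ • β₀))) := fun k =>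
    ⟨((β₀ j)⁻¹ • β₀) k, IntermediateField.subset_adjoin ℚ _ ⟨k, rfl⟩⟩
  have hb : ∀ k, (b k : ℂ) = ((β₀ j)⁻¹ • β₀) k := fun k => rfl
  have hbj : b j = 1 := Subtype.ext (by rw [hb, hj]; rfl)
  refine ⟨↥(IntermediateField.adjoin ℚ (Set.range ((β₀ j)⁻¹ • β₀))), inferInstance, inferInstance,
    b, ?_, ?_, ?_, ?_, ?_, ?_, ?_⟩
  · -- `b ≠ 0`
    intro h
    have := congrFun h j
    rw [hbj] at this
    exact one_ne_zero this
  · -- (A)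
    exact fun β => mem_projZeros_iff h𝔭 hhom hunm hb' hj hb β
  · -- (B′)
    exact fun σ τ l h => embedding_eq_of_proportional hj hb σ τ l h
  · -- (B)
    exact finrank_eq_ideg h𝔭 hhom hunm hb' hj hb
  · -- (C)
    refine (logHeight_le h𝔭 hhom hunm hb' hj hb).trans ?_
    gcongr
    exact le_add_of_nonneg_left (Nat.cast_nonneg _)
  · -- (D)
    exact fun ω hω => exp_mul_prod_projDist_le_iabs h𝔭 hhom hunm hb' hj hb hω
  · -- (E)
    exact fun hb0 δ hH z => exists_poly_of_interpolation h𝔭 hhom hunm hb' hj hb hb0 δ hH z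

end Summit.Schanuel.Schanuel.Cruxes.ApproximationProperty.OrbitInterpolationDeterminant

end
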